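import Summits.ABC.IUTFork.Cor312VolumesPadicLatticeScaled
import HarnessLib

/-!
# [IUTchIII] Corollary 3.12, statement — (Ind1)/(Ind2) fix EVERY permutation-compatible, (Ind2)-stable
# FAMILY of summand lattices `e⁻¹(Π_{v⃗} Λ_{v⃗})`, in particular the symmetric scale families `Π_{v⃗} c(v⃗)·I_{v⃗}`

Proof-only companion (D-0012; abc-iut cell, seat abc-iut-w5-d250 gen 5, G1-Θ hands item «(U1)-LATTICE» of
abc-iut-w5-d166's SHAPES memo §2 (U1) / §4 (ii)) of abc-iut-c312-5's `Cor312VolumesPadicLattice` (gen 3) and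
`Cor312VolumesPadicLatticeScaled` (gen 4); TAKES NO SIDE on [IUTchIII] Cor. 3.12. Those files prove, on the real
prime packets of a `p`-adic presentation `P` of c312-1's log-shell carriers, that every (Ind1)- or (Ind2)-family maps
the preimage of a SCALED LOG-SHELL lattice onto itself — `e⁻¹(Π_{v⃗} c·I_{v⃗})` for one constant `c` (gen 3
`family_image_latticePk`, `image_latticePk_of_mem_closure`) and `latticePkS c = e⁻¹(Π_{v⃗} c(v⃗)·I_{v⃗})` for a
capsule-SYMMETRIC scalar function `c(v⃗∘σ) = c(v⃗)` (gen 4 `family_image_latticePkS_of_symm`,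
`image_latticePkS_of_mem_closure_of_symm`, with the full (Ind1)-orbit description `image_latticePkS_mem_orbit_iff` for
non-symmetric `c`) — the `hW` input of abc-iut-c312-7's `Setting.hullDefined_of_stable` / `sUnion_possibleImages_subset`.
ATTRIBUTION NOTE (v2): the symmetric SCALAR-family case asked for in w5-d166's SHAPES §2 (U1) ("the symmetric-family
version `e⁻¹(Π_{v⃗} c(v⃗)·I_{v⃗})`, `c ∘ σ = c`, is the needed generalisation") was thus ALREADY in the tree as c312-5 gen 4's
`latticePkS` API; §3 (2) below restates it over the explicit set (definitionally `latticePkS`,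
`preimage_pi_smul_logShell_eq_latticePkS`) and consumers should cite c312-5's names for it. What THIS FILE adds is the
general form, by the same pure set algebra (no statement about the kernel of the comparison `e`), for families of
summand subsets that are NOT scalar multiples of the log-shell (scaled hulls, `Aut(X_{v⃗} : I_{v⃗})`-stable bodies):

* §1 for ANY family `Λ : v⃗ ↦ Λ_{v⃗} ⊆ X_{v⃗}` of subsets of the real summands that is
  (a) PERMUTATION-COMPATIBLE, `perm_σ(Λ_{v⃗∘σ}) = Λ_{v⃗}` (`P.permX σ e '' Λ (e ∘ σ) = Λ e`), and
  (b) (Ind2)-STABLE summandwise, `ψ(Λ_{v⃗}) = Λ_{v⃗}` for every `ψ ∈ indTwo = Aut(X_{v⃗} : log_p(R^×_{v⃗}))`,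
  the summand permutation `permΨ σ` and every summandwise `⊗_a g'_a` with shell-preserving `ℚ_p`-linear factors map
  `Π_{v⃗} Λ_{v⃗}` onto itself (`permΨ_image_pi_of_compat`, `congr_image_pi_of_stable`);
* §2 DESCENT along the comparison (c312-5's `comparison_permute`, `comparison_factorwise`,
  `image_preimage_eq_of_semiconj`): `permute σ`, every factor-and-summand-wise `Ism`/strip family, hence EVERY
  (Ind1)- or (Ind2)-family and every element of the indeterminacy subgroup `⟨Ind1Family ∪ Ind2Family⟩` maps
  `e⁻¹(Π_{v⃗} Λ_{v⃗})` onto itself (`family_image_preimage_pi`, `image_preimage_pi_of_mem_closure`), and every subset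
  of it stays inside under all of them (`image_subset_preimage_pi_of_mem_closure`);
* §3 INSTANCES: the symmetric scale families `Λ_{v⃗} = c(v⃗)·I_{v⃗}` with `c(v⃗∘σ) = c(v⃗)`
  (`family_image_latticePkFam`, `image_latticePkFam_of_mem_closure` — the same sets and statements as c312-5 gen 4's
  `family_image_latticePkS_of_symm` / `image_latticePkS_of_mem_closure_of_symm`, see §4; `c` constant recovers gen 3's
  `latticePk`, `latticePk_eq_preimage_pi`), the `p`-power scales `p^{m(v⃗)}·I_{v⃗}` with a permutation-symmetric exponent
  `m : v⃗ ↦ ℤ` (`family_image_latticePkZPow`, `image_latticePkZPow_of_mem_closure`) — the shape of the content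
  exponents of the sharp bound —, and scaled (Ind2)-stable symmetric families `c(v⃗)·S_{v⃗}`
  (`family_image_smul_pi`);
* §4 BRIDGE to c312-5 gen 4: `e⁻¹(Π_{v⃗} c(v⃗)·I_{v⃗})` written as an explicit preimage IS `latticePkS c`
  (`preimage_pi_smul_logShell_eq_latticePkS`, `rfl`), so §3 (2) and c312-5's symmetric-lattice theorems are
  interchangeable (`family_image_latticePkFam_eq_latticePkS` restates §3 (2) through `latticePkS`).

Dupuy–Hilado (arXiv:2004.13228) §4 intro / §4.7 / §4.9, read in c312-5's file: "elements of Ind1 are just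
automorphisms … induced by automorphisms of the `ℤ_p`-lattice `I^{⊗ j+1}_{V̲,p} = ⊕_{v⃗} I_{v⃗}`", "This map … fixes the
lattice", "the Ind2 indeterminacies also preserve this lattice" — the summand-by-summand mechanism is literally the
same for any lattice family permuted among itself by the capsule permutations. [cite: DupuyHilado2025, §4 (intro),
§4.7, §4.9]. HONEST FRAMING: generic set algebra over c312-5's presentation; no new definition, no edit to any
other seat's file, no judgement on Cor. 3.12; typed ≠ proved for the disputed step itself.
-/

noncomputable section

open Set Function PiTensorProduct
open scoped TensorProduct Pointwise

namespace Summit.ABC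

namespace IUTFork

namespace Cor312Vol

namespace PadicPresentation

open Thm311 Literature.IUT.LogThetaLattice Literature.IUT.LogVolume Literature.LinearAlgebra.BaseChange

variable {T : ThetaIndex} {L : LogShells T} {vQ : T.VQ} {p : ℕ} [hp : Fact p.Prime]
  (P : PadicPresentation L vQ p) {j : T.Label}

/-! ## 1. Permutation-compatible, (Ind2)-stable summand families are fixed summand-by-summand -/

/-- **(Ind1), permutation part, fixes `Π_{v⃗} Λ_{v⃗}`** for a PERMUTATION-COMPATIBLE family
(`perm_σ(Λ_{v⃗∘σ}) = Λ_{v⃗}`): the summand permutation `permΨ σ` maps `Π_{v⃗} Λ_{v⃗}` onto itself ("This map … fixes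
the lattice", summand by summand). [cite: DupuyHilado2025, §4.7] -/
theorem permΨ_image_pi_of_compat (Λ : ∀ e : T.Caps j → T.Fibre vQ, Set (P.X e))
    (hperm : ∀ (σ : Equiv.Perm (T.Caps j)) (e : T.Caps j → T.Fibre vQ), P.permX σ e '' Λ (e ∘ σ) = Λ e)
    (σ : Equiv.Perm (T.Caps j)) : P.permΨ σ '' Set.pi univ Λ = Set.pi univ Λ := by
  rw [permΨ_image_pi]
  exact congrArg (Set.pi univ) (funext fun e => hperm σ e)

/-- **(Ind2)-type summandwise families fix `Π_{v⃗} Λ_{v⃗}`** for an (Ind2)-STABLE family: for `ℚ_p`-linear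
`g'_{a,v}` preserving `log_p(𝒪^×_{K_v})`, the summandwise map `y ↦ (⊗_a g'_{a,v⃗ a})(y_{v⃗})` lies in `indTwo`
summand by summand (c312-5 `congr_mem_indTwo`), so maps the family onto itself ("the Ind2 indeterminacies also
preserve this lattice"). [cite: DupuyHilado2025, §4.9] -/
theorem congr_image_pi_of_stable (Λ : ∀ e : T.Caps j → T.Fibre vQ, Set (P.X e))
    (hind : ∀ (e : T.Caps j → T.Fibre vQ) (ψ : P.X e ≃ₗ[ℚ_[p]] P.X e),
      ψ ∈ indTwo p (P.kk e) → ψ '' Λ e = Λ e)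
    (g' : T.Caps j → ∀ v : T.Fibre vQ, P.k v ≃ₗ[ℚ_[p]] P.k v)
    (hlog : ∀ i v, g' i v '' logUnits (P.k v) = logUnits (P.k v)) :
    (fun (y : ∀ e : T.Caps j → T.Fibre vQ, P.X e) e =>
        (PiTensorProduct.congr fun a => g' a (e a) : P.X e ≃ₗ[ℚ_[p]] P.X e) (y e)) '' Set.pi univ Λ =
      Set.pi univ Λ := by
  have h := Set.piMap_image_univ_pi
    (fun e : T.Caps j → T.Fibre vQ => ⇑(PiTensorProduct.congr fun a => g' a (e a) : P.X e ≃ₗ[ℚ_[p]] P.X e)) Λ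
  rw [show (fun (y : ∀ e : T.Caps j → T.Fibre vQ, P.X e) e =>
      (PiTensorProduct.congr fun a => g' a (e a) : P.X e ≃ₗ[ℚ_[p]] P.X e) (y e)) =
      Pi.map (fun e => ⇑(PiTensorProduct.congr fun a => g' a (e a) : P.X e ≃ₗ[ℚ_[p]] P.X e)) from rfl, h]
  exact congrArg (Set.pi univ) (funext fun e =>
    hind e _ (P.congr_mem_indTwo e _ fun a => hlog a (e a)))

/-! ## 2. Descent along the comparison: every (Ind1)/(Ind2)-family maps `e⁻¹(Π_{v⃗} Λ_{v⃗})` onto itself -/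

/-- `permute σ` maps `e⁻¹(Π_{v⃗} Λ_{v⃗})` onto itself (permutation-compatible family; descent of §1 along
c312-5's `comparison_permute`). [cite: DupuyHilado2025, §4.7] -/
theorem permute_image_preimage_pi (Λ : ∀ e : T.Caps j → T.Fibre vQ, Set (P.X e))
    (hperm : ∀ (σ : Equiv.Perm (T.Caps j)) (e : T.Caps j → T.Fibre vQ), P.permX σ e '' Λ (e ∘ σ) = Λ e)
    (σ : Equiv.Perm (T.Caps j)) :
    L.permute j vQ σ '' (P.comparison j ⁻¹' Set.pi univ Λ) = P.comparison j ⁻¹' Set.pi univ Λ :=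
  image_preimage_eq_of_semiconj (L.permute j vQ σ).surjective (P.permΨ σ).injective (P.comparison_permute σ)
    (P.permΨ_image_pi_of_compat Λ hperm σ)

/-- A factor-and-summand-wise family intertwined with shell-preserving `ℚ_p`-linear maps maps `e⁻¹(Π_{v⃗} Λ_{v⃗})`
onto itself ((Ind2)-stable family; descent of §1 along c312-5's `comparison_factorwise`).
[cite: DupuyHilado2025, §4.9] -/
theorem factorwise_image_preimage_pi (Λ : ∀ e : T.Caps j → T.Fibre vQ, Set (P.X e))
    (hind : ∀ (e : T.Caps j → T.Fibre vQ) (ψ : P.X e ≃ₗ[ℚ_[p]] P.X e),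
      ψ ∈ indTwo p (P.kk e) → ψ '' Λ e = Λ e)
    (g : T.Caps j → ∀ v : T.Fibre vQ, L.carrier v.1 ≃ₗ[ℚ] L.carrier v.1)
    (g' : T.Caps j → ∀ v : T.Fibre vQ, P.k v ≃ₗ[ℚ_[p]] P.k v)
    (hg' : ∀ i v x, P.φ v (g i v x) = g' i v (P.φ v x))
    (hlog : ∀ i v, g' i v '' logUnits (P.k v) = logUnits (P.k v)) :
    L.factorwise j vQ (fun i => L.summandwise vQ (g i)) '' (P.comparison j ⁻¹' Set.pi univ Λ) =
      P.comparison j ⁻¹' Set.pi univ Λ := by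
  refine image_preimage_eq_of_semiconj (LinearEquiv.surjective _) (fun y y' h => ?_)
    (P.comparison_factorwise g g' hg') (P.congr_image_pi_of_stable Λ hind g' hlog)
  funext e
  exact (PiTensorProduct.congr fun a => g' a (e a) : P.X e ≃ₗ[ℚ_[p]] P.X e).injective (congrFun h e)

/-- **(Ind2) maps `e⁻¹(Π_{v⃗} Λ_{v⃗})` onto itself** (families of `Ism`-elements of the presented signature;
(Ind2)-stable family). [cite: DupuyHilado2025, §4.9] -/
theorem ism_image_preimage_pi (Λ : ∀ e : T.Caps j → T.Fibre vQ, Set (P.X e))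
    (hind : ∀ (e : T.Caps j → T.Fibre vQ) (ψ : P.X e ≃ₗ[ℚ_[p]] P.X e),
      ψ ∈ indTwo p (P.kk e) → ψ '' Λ e = Λ e)
    (g : T.Caps j → ∀ v : T.Fibre vQ, L.carrier v.1 ≃ₗ[ℚ] L.carrier v.1)
    (hg : ∀ i v, g i v ∈ L.ism v.1) :
    L.factorwise j vQ (fun i => L.summandwise vQ (g i)) '' (P.comparison j ⁻¹' Set.pi univ Λ) =
      P.comparison j ⁻¹' Set.pi univ Λ := by
  choose g' hg' using fun i v => P.ism_linear v (g i v) (hg i v)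
  exact P.factorwise_image_preimage_pi Λ hind g g' hg'
    (fun i v => P.image_logUnits_eq (hg' i v) (P.ism_shell v _ (hg i v)))

/-- **The strip part of (Ind1) maps `e⁻¹(Π_{v⃗} Λ_{v⃗})` onto itself** ((Ind2)-stable family).
[cite: DupuyHilado2025, §4.7] -/
theorem strip_image_preimage_pi (Λ : ∀ e : T.Caps j → T.Fibre vQ, Set (P.X e))
    (hind : ∀ (e : T.Caps j → T.Fibre vQ) (ψ : P.X e ≃ₗ[ℚ_[p]] P.X e),
      ψ ∈ indTwo p (P.kk e) → ψ '' Λ e = Λ e)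
    (g : T.Caps j → ∀ v : T.Fibre vQ, L.carrier v.1 ≃ₗ[ℚ] L.carrier v.1)
    (hg : ∀ i v, g i v ∈ L.stripAut v.1) :
    L.factorwise j vQ (fun i => L.summandwise vQ (g i)) '' (P.comparison j ⁻¹' Set.pi univ Λ) =
      P.comparison j ⁻¹' Set.pi univ Λ := by
  choose g' hg' using fun i v => P.strip_linear v (g i v) (hg i v)
  exact P.factorwise_image_preimage_pi Λ hind g g' hg'
    (fun i v => P.image_logUnits_eq (hg' i v) (P.strip_shell v _ (hg i v)))

/-- **Every (Ind1)- or (Ind2)-FAMILY maps `e⁻¹(Π_{v⃗} Λ_{v⃗})` onto itself at `(j, v_ℚ)`**, for every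
permutation-compatible (Ind2)-stable family of summand subsets — the hypothesis `hW` of abc-iut-c312-7's
`Setting.hullDefined_of_stable` / `Setting.sUnion_possibleImages_subset` for `W = e⁻¹(Π_{v⃗} Λ_{v⃗})` (Dupuy–Hilado
§4: "induced by automorphisms of the `ℤ_p`-lattice `I^{⊗ j+1}_{V̲,p} = ⊕_{v⃗} I_{v⃗}`", "the Ind2 indeterminacies also
preserve this lattice"; c312-5's `family_image_latticePk` is the constant family `Λ_{v⃗} = c·I_{v⃗}`).
[cite: DupuyHilado2025, §4 (intro), §4.7, §4.9] -/
theorem family_image_preimage_pi {Φ : L.PacketAut} (hΦ : Φ ∈ L.Ind1Family ∪ L.Ind2Family)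
    (Λ : ∀ e : T.Caps j → T.Fibre vQ, Set (P.X e))
    (hperm : ∀ (σ : Equiv.Perm (T.Caps j)) (e : T.Caps j → T.Fibre vQ), P.permX σ e '' Λ (e ∘ σ) = Λ e)
    (hind : ∀ (e : T.Caps j → T.Fibre vQ) (ψ : P.X e ≃ₗ[ℚ_[p]] P.X e),
      ψ ∈ indTwo p (P.kk e) → ψ '' Λ e = Λ e) :
    Φ j vQ '' (P.comparison j ⁻¹' Set.pi univ Λ) = P.comparison j ⁻¹' Set.pi univ Λ := by
  rcases hΦ with hΦ | hΦ
  · obtain ⟨σ, h, hh, hΦj⟩ := hΦ j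
    have hΦj' : Φ j vQ = (L.permute j vQ σ).trans
        (L.factorwise j vQ fun i => L.summandwise vQ fun v : T.Fibre vQ => h i v.1) := hΦj vQ
    have hcomp : (⇑(Φ j vQ) : L.Packet j vQ → L.Packet j vQ) =
        ⇑(L.factorwise j vQ fun i => L.summandwise vQ fun v : T.Fibre vQ => h i v.1) ∘ ⇑(L.permute j vQ σ) := by
      rw [hΦj']; rfl
    rw [hcomp, Set.image_comp, P.permute_image_preimage_pi Λ hperm σ]
    exact P.strip_image_preimage_pi Λ hind (fun i v => h i v.1) (fun i v => hh i v.1)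
  · obtain ⟨g, hg, hΦj⟩ := hΦ j vQ
    rw [hΦj]
    exact P.ism_image_preimage_pi Λ hind g hg

/-- Hence every element of the indeterminacy subgroup `⟨Ind1Family ∪ Ind2Family⟩` (c312-7's `Setting.indGroup`)
maps `e⁻¹(Π_{v⃗} Λ_{v⃗})` onto itself, for every permutation-compatible (Ind2)-stable family.
[cite: DupuyHilado2025, §4 (intro)] -/
theorem image_preimage_pi_of_mem_closure {Φ : L.PacketAut}
    (hΦ : Φ ∈ Subgroup.closure (L.Ind1Family ∪ L.Ind2Family))
    (Λ : ∀ e : T.Caps j → T.Fibre vQ, Set (P.X e))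
    (hperm : ∀ (σ : Equiv.Perm (T.Caps j)) (e : T.Caps j → T.Fibre vQ), P.permX σ e '' Λ (e ∘ σ) = Λ e)
    (hind : ∀ (e : T.Caps j → T.Fibre vQ) (ψ : P.X e ≃ₗ[ℚ_[p]] P.X e),
      ψ ∈ indTwo p (P.kk e) → ψ '' Λ e = Λ e) :
    Φ j vQ '' (P.comparison j ⁻¹' Set.pi univ Λ) = P.comparison j ⁻¹' Set.pi univ Λ := by
  induction hΦ using Subgroup.closure_induction with
  | mem Ψ hΨ => exact P.family_image_preimage_pi hΨ Λ hperm hind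
  | one => simp
  | mul Ψ₁ Ψ₂ _ _ ih₁ ih₂ =>
    have hcomp : ⇑((Ψ₁ * Ψ₂) j vQ) = ⇑(Ψ₁ j vQ) ∘ ⇑(Ψ₂ j vQ) := by
      funext x
      rfl
    rw [hcomp, Set.image_comp, ih₂, ih₁]
  | inv Ψ _ ih =>
    change ⇑((Ψ j vQ).symm) '' (P.comparison j ⁻¹' Set.pi univ Λ) = P.comparison j ⁻¹' Set.pi univ Λ
    conv_lhs => rw [← ih]
    rw [Set.image_image]
    simp only [LinearEquiv.symm_apply_apply, Set.image_id']

/-- **Regions inside `e⁻¹(Π_{v⃗} Λ_{v⃗})` stay inside under the whole indeterminacy subgroup**: if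
`R ⊆ e⁻¹(Π_{v⃗} Λ_{v⃗})` then `Φ(R) ⊆ e⁻¹(Π_{v⃗} Λ_{v⃗})` for every `Φ ∈ ⟨Ind1Family ∪ Ind2Family⟩` — the form in which a
per-summand enclosure of the Θ-region bounds ALL its possible images (the union over (Ind1), (Ind2) of
[IUTchIII] Cor. 3.12's proof, p. 175 l. 2–4). [cite: DupuyHilado2025, §4 (intro)] -/
theorem image_subset_preimage_pi_of_mem_closure {Φ : L.PacketAut}
    (hΦ : Φ ∈ Subgroup.closure (L.Ind1Family ∪ L.Ind2Family))
    (Λ : ∀ e : T.Caps j → T.Fibre vQ, Set (P.X e))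
    (hperm : ∀ (σ : Equiv.Perm (T.Caps j)) (e : T.Caps j → T.Fibre vQ), P.permX σ e '' Λ (e ∘ σ) = Λ e)
    (hind : ∀ (e : T.Caps j → T.Fibre vQ) (ψ : P.X e ≃ₗ[ℚ_[p]] P.X e),
      ψ ∈ indTwo p (P.kk e) → ψ '' Λ e = Λ e)
    {R : Set (L.Packet j vQ)} (hR : R ⊆ P.comparison j ⁻¹' Set.pi univ Λ) :
    Φ j vQ '' R ⊆ P.comparison j ⁻¹' Set.pi univ Λ :=
  (Set.image_mono hR).trans (P.image_preimage_pi_of_mem_closure hΦ Λ hperm hind).le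

/-! ## 3. Instances: symmetric scale families `c(v⃗)·I_{v⃗}`, `p`-power scales, scaled stable families -/

/-- The factor permutation maps `c(v⃗∘σ)·I_{v⃗∘σ}` onto `c(v⃗)·I_{v⃗}` for a PERMUTATION-SYMMETRIC scale family
`c(v⃗∘σ) = c(v⃗)` (c312-5's `permX_image_smul_logShell` for one scale, then symmetry). [cite: DupuyHilado2025, §4.7] -/
theorem permX_image_smul_logShell_of_symm (c : (T.Caps j → T.Fibre vQ) → ℚ_[p])
    (hc : ∀ (σ : Equiv.Perm (T.Caps j)) (e : T.Caps j → T.Fibre vQ), c (e ∘ σ) = c e)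
    (σ : Equiv.Perm (T.Caps j)) (e : T.Caps j → T.Fibre vQ) :
    P.permX σ e '' (c (e ∘ σ) • logShell p (P.kk (e ∘ σ))) = c e • logShell p (P.kk e) := by
  rw [P.permX_image_smul_logShell σ e (c (e ∘ σ)), hc σ e]

/-- c312-5's single-scale lattice IS the constant family: `latticePk c = e⁻¹(Π_{v⃗} c·I_{v⃗})`, definitionally.
[cite: DupuyHilado2025, §4 (intro)] -/
theorem latticePk_eq_preimage_pi (j : T.Label) (c : ℚ_[p]) :
    P.latticePk j c = P.comparison j ⁻¹' Set.pi univ fun e : T.Caps j → T.Fibre vQ => c • logShell p (P.kk e) :=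
  rfl

/-- **Every (Ind1)- or (Ind2)-family maps the SYMMETRIC-FAMILY log-shell lattice `e⁻¹(Π_{v⃗} c(v⃗)·I_{v⃗})` onto
itself**, for every scale family `c` with `c(v⃗∘σ) = c(v⃗)` — the generalisation of c312-5's `family_image_latticePk`
asked for by the sharp Θ-side bound (abc-iut-w5-d166, G1-Θ SHAPES §2 (U1)); the `hW` input of
`Setting.hullDefined_of_stable` for this `W`. [cite: DupuyHilado2025, §4 (intro), §4.7, §4.9] -/
theorem family_image_latticePkFam {Φ : L.PacketAut} (hΦ : Φ ∈ L.Ind1Family ∪ L.Ind2Family) (j : T.Label)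
    (c : (T.Caps j → T.Fibre vQ) → ℚ_[p])
    (hc : ∀ (σ : Equiv.Perm (T.Caps j)) (e : T.Caps j → T.Fibre vQ), c (e ∘ σ) = c e) :
    Φ j vQ '' (P.comparison j ⁻¹' Set.pi univ fun e : T.Caps j → T.Fibre vQ => c e • logShell p (P.kk e)) =
      P.comparison j ⁻¹' Set.pi univ fun e : T.Caps j → T.Fibre vQ => c e • logShell p (P.kk e) :=
  P.family_image_preimage_pi hΦ (fun e => c e • logShell p (P.kk e))
    (fun σ e => P.permX_image_smul_logShell_of_symm c hc σ e)
    (fun e _ hψ => P.image_smul_logShell_of_mem_indTwo hψ (c e))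

/-- … hence so does every element of the indeterminacy subgroup `⟨Ind1Family ∪ Ind2Family⟩`.
[cite: DupuyHilado2025, §4 (intro)] -/
theorem image_latticePkFam_of_mem_closure {Φ : L.PacketAut}
    (hΦ : Φ ∈ Subgroup.closure (L.Ind1Family ∪ L.Ind2Family)) (j : T.Label)
    (c : (T.Caps j → T.Fibre vQ) → ℚ_[p])
    (hc : ∀ (σ : Equiv.Perm (T.Caps j)) (e : T.Caps j → T.Fibre vQ), c (e ∘ σ) = c e) :
    Φ j vQ '' (P.comparison j ⁻¹' Set.pi univ fun e : T.Caps j → T.Fibre vQ => c e • logShell p (P.kk e)) =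
      P.comparison j ⁻¹' Set.pi univ fun e : T.Caps j → T.Fibre vQ => c e • logShell p (P.kk e) :=
  P.image_preimage_pi_of_mem_closure hΦ (fun e => c e • logShell p (P.kk e))
    (fun σ e => P.permX_image_smul_logShell_of_symm c hc σ e)
    (fun e _ hψ => P.image_smul_logShell_of_mem_indTwo hψ (c e))

/-- **The `p`-POWER scale family `e⁻¹(Π_{v⃗} p^{m(v⃗)}·I_{v⃗})` with a permutation-symmetric INTEGER exponent
`m(v⃗∘σ) = m(v⃗)`** (the shape of the content exponents of the Θ-pilot slots) is mapped onto itself by every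
(Ind1)- or (Ind2)-family. [cite: DupuyHilado2025, §4 (intro), §4.7, §4.9] -/
theorem family_image_latticePkZPow {Φ : L.PacketAut} (hΦ : Φ ∈ L.Ind1Family ∪ L.Ind2Family) (j : T.Label)
    (m : (T.Caps j → T.Fibre vQ) → ℤ)
    (hm : ∀ (σ : Equiv.Perm (T.Caps j)) (e : T.Caps j → T.Fibre vQ), m (e ∘ σ) = m e) :
    Φ j vQ '' (P.comparison j ⁻¹' Set.pi univ fun e : T.Caps j → T.Fibre vQ =>
        ((p : ℚ_[p]) ^ m e) • logShell p (P.kk e)) =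
      P.comparison j ⁻¹' Set.pi univ fun e : T.Caps j → T.Fibre vQ => ((p : ℚ_[p]) ^ m e) • logShell p (P.kk e) :=
  P.family_image_latticePkFam hΦ j (fun e => (p : ℚ_[p]) ^ m e) (fun σ e => by rw [hm σ e])

/-- … and by every element of the indeterminacy subgroup. [cite: DupuyHilado2025, §4 (intro)] -/
theorem image_latticePkZPow_of_mem_closure {Φ : L.PacketAut}
    (hΦ : Φ ∈ Subgroup.closure (L.Ind1Family ∪ L.Ind2Family)) (j : T.Label)
    (m : (T.Caps j → T.Fibre vQ) → ℤ)
    (hm : ∀ (σ : Equiv.Perm (T.Caps j)) (e : T.Caps j → T.Fibre vQ), m (e ∘ σ) = m e) :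
    Φ j vQ '' (P.comparison j ⁻¹' Set.pi univ fun e : T.Caps j → T.Fibre vQ =>
        ((p : ℚ_[p]) ^ m e) • logShell p (P.kk e)) =
      P.comparison j ⁻¹' Set.pi univ fun e : T.Caps j → T.Fibre vQ => ((p : ℚ_[p]) ^ m e) • logShell p (P.kk e) :=
  P.image_latticePkFam_of_mem_closure hΦ j (fun e => (p : ℚ_[p]) ^ m e) (fun σ e => by rw [hm σ e])

/-- A subset of the `p`-power family lattice has ALL its possible images inside it: `R ⊆ e⁻¹(Π_{v⃗} p^{m(v⃗)}·I_{v⃗})`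
⟹ `Φ(R) ⊆ e⁻¹(Π_{v⃗} p^{m(v⃗)}·I_{v⃗})` for `Φ ∈ ⟨Ind1Family ∪ Ind2Family⟩` (the per-summand enclosure feeding the
sharp Θ-side volume bound). [cite: DupuyHilado2025, §4 (intro)] -/
theorem image_subset_latticePkZPow_of_mem_closure {Φ : L.PacketAut}
    (hΦ : Φ ∈ Subgroup.closure (L.Ind1Family ∪ L.Ind2Family)) (j : T.Label)
    (m : (T.Caps j → T.Fibre vQ) → ℤ)
    (hm : ∀ (σ : Equiv.Perm (T.Caps j)) (e : T.Caps j → T.Fibre vQ), m (e ∘ σ) = m e)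
    {R : Set (L.Packet j vQ)}
    (hR : R ⊆ P.comparison j ⁻¹' Set.pi univ fun e : T.Caps j → T.Fibre vQ =>
      ((p : ℚ_[p]) ^ m e) • logShell p (P.kk e)) :
    Φ j vQ '' R ⊆ P.comparison j ⁻¹' Set.pi univ fun e : T.Caps j → T.Fibre vQ =>
      ((p : ℚ_[p]) ^ m e) • logShell p (P.kk e) :=
  (Set.image_mono hR).trans (P.image_latticePkZPow_of_mem_closure hΦ j m hm).le

/-- **Scaled (Ind2)-stable symmetric families**: if `S_{v⃗} ⊆ X_{v⃗}` is permutation-compatible and (Ind2)-stable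
and `c(v⃗∘σ) = c(v⃗)`, then every (Ind1)- or (Ind2)-family maps `e⁻¹(Π_{v⃗} c(v⃗)·S_{v⃗})` onto itself (e.g. `S` = the
log-shell hulls, or any `Aut(X_{v⃗} : I_{v⃗})`-invariant body). [cite: DupuyHilado2025, §4 (intro), §4.7, §4.9] -/
theorem family_image_smul_pi {Φ : L.PacketAut} (hΦ : Φ ∈ L.Ind1Family ∪ L.Ind2Family)
    (S : ∀ e : T.Caps j → T.Fibre vQ, Set (P.X e))
    (hSperm : ∀ (σ : Equiv.Perm (T.Caps j)) (e : T.Caps j → T.Fibre vQ), P.permX σ e '' S (e ∘ σ) = S e)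
    (hSind : ∀ (e : T.Caps j → T.Fibre vQ) (ψ : P.X e ≃ₗ[ℚ_[p]] P.X e),
      ψ ∈ indTwo p (P.kk e) → ψ '' S e = S e)
    (c : (T.Caps j → T.Fibre vQ) → ℚ_[p])
    (hc : ∀ (σ : Equiv.Perm (T.Caps j)) (e : T.Caps j → T.Fibre vQ), c (e ∘ σ) = c e) :
    Φ j vQ '' (P.comparison j ⁻¹' Set.pi univ fun e : T.Caps j → T.Fibre vQ => c e • S e) =
      P.comparison j ⁻¹' Set.pi univ fun e : T.Caps j → T.Fibre vQ => c e • S e := by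
  refine P.family_image_preimage_pi hΦ (fun e => c e • S e) (fun σ e => ?_) (fun e ψ hψ => ?_)
  · -- `perm_σ(c(v⃗∘σ)·S_{v⃗∘σ}) = c(v⃗∘σ)·perm_σ(S_{v⃗∘σ}) = c(v⃗)·S_{v⃗}`
    have h1 : ⇑(P.permX σ e) '' (c (e ∘ σ) • S (e ∘ σ)) = c (e ∘ σ) • (⇑(P.permX σ e) '' S (e ∘ σ)) := by
      rw [← image_smul, ← image_smul, image_image, image_image]
      exact image_congr fun x _ => by simp only [map_smul]
    change ⇑(P.permX σ e) '' (c (e ∘ σ) • S (e ∘ σ)) = c e • S e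
    rw [h1, hSperm σ e, hc σ e]
  · rw [image_const_smul p (P.kk e) ψ (c e) (S e), hSind e ψ hψ]

/-! ## 4. Bridge to c312-5 gen 4's `latticePkS` (the symmetric scalar-family case was already in the tree) -/

/-- The explicit preimage `e⁻¹(Π_{v⃗} c(v⃗)·I_{v⃗})` of §3 IS c312-5 gen 4's `latticePkS c` (`Cor312VolumesPadicLatticeScaled`),
definitionally — so `family_image_latticePkFam` / `image_latticePkFam_of_mem_closure` above are c312-5's
`family_image_latticePkS_of_symm` / `image_latticePkS_of_mem_closure_of_symm` in explicit-set phrasing; cite c312-5's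
names for the scalar-family case. [cite: DupuyHilado2025, §4 (intro)] -/
theorem preimage_pi_smul_logShell_eq_latticePkS (j : T.Label) (c : (T.Caps j → T.Fibre vQ) → ℚ_[p]) :
    (P.comparison j ⁻¹' Set.pi univ fun e : T.Caps j → T.Fibre vQ => c e • logShell p (P.kk e)) =
      P.latticePkS j c :=
  rfl

/-- §3 (2) through c312-5's def: every (Ind1)/(Ind2)-family fixes `latticePkS c` for capsule-symmetric `c` — obtained
here from the GENERAL-family theorem `family_image_preimage_pi` (c312-5 gen 4 proves the same via the (Ind1)-orbit
`exists_perm_image_latticePkS_of_mem_closure`; the two routes agree). [cite: DupuyHilado2025, §4 (intro), §4.7, §4.9] -/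
theorem family_image_latticePkFam_eq_latticePkS {Φ : L.PacketAut} (hΦ : Φ ∈ L.Ind1Family ∪ L.Ind2Family)
    (j : T.Label) (c : (T.Caps j → T.Fibre vQ) → ℚ_[p])
    (hc : ∀ (σ : Equiv.Perm (T.Caps j)) (e : T.Caps j → T.Fibre vQ), c (e ∘ σ) = c e) :
    Φ j vQ '' P.latticePkS j c = P.latticePkS j c :=
  P.family_image_latticePkFam hΦ j c hc

end PadicPresentation

end Cor312Vol

end IUTFork

end Summit.ABC

end
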